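import Summits.QuantumFields.BalabanUV.Beta.FP.TorusCompositeCompanionSumG

/-!
# `BalabanUV.Beta.FP.TorusCompositeCompanionFamilyG` — road «FP», ROUTE T (the nested tower): **THE NAMED TORUS-INDEXED COMPANION FAMILY**
# of a storey-indexed prescription, beside `TorusCompositeCompanionSumG.compSumG ∕ compSumSym` (leaf-05 g45 Q-leaf05-g45-1 ∕ W-2: the `def`
# edition of `TowerCompanionInstance` §2's witness, filed ONLY on the OWNER d1-p3's word; typing fact = leaf-06 g38 W-1 ∕ A-9)

WHY.  `compSumG ∕ compSumSym` consume companions INDEXED BY THE TORUS THEY LIVE ON (`G : ∀ T, Matrix (↥(pbox T) × Fin (d+1)) (same) ℝ`; storey `k` of the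
tower over `M` reads `G (towerTorus Lc M k)`, the top storey `G M` literally — leaf-06 g37 W-2: `HMul ∕ HAdd` are found only on syntactically equal index
types), while a door's storey data (weights, directions, coefficients) is indexed BY THE STOREY `k`.  For `2 ≤ Lc` the storey tori `towerTorus Lc M k = Lc^k • M`
are pairwise distinct (§1), so a storey-indexed prescription `F k` EXTENDS BY ZERO to a torus-indexed family — ONE function of the data, so that a first-order
jet `H₁f B v := … + compSumSym Lc (onTowerFamily Lc M (F B v)) M lev rs n` can be WRITTEN in a statement, uniformly and linearly in the direction `v`
(leaf-05 g45 A-1: the door of the pass displays `hH₁l`; an `obtain ⟨G, …⟩` per direction cannot supply it).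

WHAT ([folklore] + [our object — bookkeeping] BY NAME over OUR typed objects; nothing of Bałaban's; nothing cited; 0 sorry):
* §1 `towerTorus_injective (hLc : 2 ≤ Lc)` — [folklore] `k ↦ towerTorus Lc M k` is injective (`towerTorus_apply`, `Nat.pow_right_injective`).
* §2 `reidx (h : T′ = T)` — membership-only re-indexing `↥(pbox T) × Fin (d+1) → ↥(pbox T′) × Fin (d+1)` (no transport of data; `reidx_rfl` is `rfl`);
  **`onTowerFamily Lc M F : ∀ T, Matrix (↥(pbox T) × Fin (d+1)) (same) ℝ`** — on a storey torus the prescribed matrix re-indexed by membership, `0` off the tower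
  (`Classical.choice` of the storey; unique by §1); `submatrix_reidx_storey` (`subst; rfl`); **`onTowerFamily_towerTorus (hLc) : onTowerFamily Lc M F (towerTorus Lc M k) = F k`**
  (EVERY `k`), `onTowerFamily_top (hLc) : onTowerFamily Lc M F M = F 0`, `onTowerFamily_eq_zero` (off the tower); **`onTowerFamily_transpose`** (antisymmetric storeys ⟹
  antisymmetric family on EVERY torus — no hypothesis on `Lc`); `onTowerFamily_add ∕ _smul` and **`onTowerFamily_linear`** (prescriptions linear in an abstract
  direction `v : V` give a family linear in `v` on every torus — with `compSumG_add ∕ compSumG_smul` this is a door's `hH₁l` for the companion term).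
WHAT THIS IS NOT: no companion is CHOSEN here (the storeys' Λ-sector families, their weights and directions are the ROW's ∕ leaf-05's instance — `TowerCompanionInstance`);
no row of any door, no hypothesis of R-FP-74's closing ∕ R-FP-75's pass; an extension-by-zero and its unfoldings, nothing else.  0 estimates; 0∕4 row-D1 binders
(hW, hR, D1Tel, D1Rep); NOT (C1), NOT (L2′), NOT (T-ID)∕(T-β) complete, NOT SDF, NOT D1, NOT BetaPertH, NOT continuum, NOT Clay.  «not in print; our bookkeeping».

HONEST DEPENDENCY (page 1, mandatory): continuum YM on T⁴ ⇐ BetaPertH ∧ nine spine estimates (0/9 proved); BetaPertH ⇐ (D1) ∧ (D4) ∧ CAP+tail;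
G-an2-4 gates asym, D1 and NE2/3/4.  D1 formalisation swarm LEAF PROVER 06 (b2b-balaban-beta-d1-formalise-leaf-06 gen 38), 2026-08-25.  No existing file touched.
-/

noncomputable section

namespace Summit.QuantumFields.BalabanUV.Beta.FP.TorusCompositeCompanionFamilyG

open Matrix
open Literature.MathematicalPhysics.QuantumFieldTheory.Balaban1983to89
open Literature.MathematicalPhysics.QuantumFieldTheory.Balaban1983to89.Beta
open B6Lemma24Torus (pbox)
open AffineAveraging (Site)
open Summit.QuantumFields.BalabanUV.Beta.FP.TorusCompositeObjects (towerTorus towerTorus_apply)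

variable {d : ℕ} (Lc : ℕ)

/-! ## §1 The storey tori of a tower are pairwise distinct (`2 ≤ Lc`) -/

/-- [folklore] for `2 ≤ Lc` the storey index is read off the torus: `k ↦ towerTorus Lc M k = Lc^k • M` is injective. -/
theorem towerTorus_injective (hLc : 2 ≤ Lc) (M : Fin (d + 1) → ℕ) [∀ μ, NeZero (M μ)] :
    Function.Injective (towerTorus Lc M) := by
  intro k k' h
  have h0 := congrFun h 0
  rw [towerTorus_apply, towerTorus_apply] at h0
  exact Nat.pow_right_injective hLc (Nat.eq_of_mul_eq_mul_right (Nat.pos_of_ne_zero (NeZero.ne (M 0))) h0)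

/-! ## §2 The named torus-indexed companion family of a storey-indexed prescription -/

/-- [our object — bookkeeping] membership-only re-indexing of the companion index type along an equality of tori (no transport of data). -/
def reidx {T T' : Fin (d + 1) → ℕ} (h : T' = T) (a : ↥(pbox T) × Fin (d + 1)) : ↥(pbox T') × Fin (d + 1) :=
  (⟨(a.1 : Site (d + 1)), by rw [h]; exact a.1.2⟩, a.2)

/-- re-indexing along `rfl` is the identity. -/
@[simp] theorem reidx_rfl {T : Fin (d + 1) → ℕ} (a : ↥(pbox T) × Fin (d + 1)) : reidx (rfl : T = T) a = a := rfl

open Classical in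
/-- **[our object — bookkeeping] `onTowerFamily Lc M F` — THE NAMED TORUS-INDEXED COMPANION FAMILY of a storey-indexed prescription `F k` on the storeys
`towerTorus Lc M k` of the tower over `M`: on a storey torus, the prescribed matrix (re-indexed by membership only); off the tower, `0`.  Indexed by the torus
exactly as `compSumG ∕ compSumSym` consume companions (`G (towerTorus Lc M k)`, top storey `G M` literally). -/
def onTowerFamily (M : Fin (d + 1) → ℕ)
    (F : (k : ℕ) → Matrix (↥(pbox (towerTorus Lc M k)) × Fin (d + 1)) (↥(pbox (towerTorus Lc M k)) × Fin (d + 1)) ℝ)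
    (T : Fin (d + 1) → ℕ) : Matrix (↥(pbox T) × Fin (d + 1)) (↥(pbox T) × Fin (d + 1)) ℝ :=
  if h : ∃ k, towerTorus Lc M k = T then (F h.choose).submatrix (reidx h.choose_spec) (reidx h.choose_spec) else 0

/-- re-indexing a storey matrix along equal storey indices is the identity (structure eta + proof irrelevance). -/
theorem submatrix_reidx_storey (M : Fin (d + 1) → ℕ)
    (F : (k : ℕ) → Matrix (↥(pbox (towerTorus Lc M k)) × Fin (d + 1)) (↥(pbox (towerTorus Lc M k)) × Fin (d + 1)) ℝ)
    {k k' : ℕ} (hk : k' = k) (h : towerTorus Lc M k' = towerTorus Lc M k) :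
    (F k').submatrix (reidx h) (reidx h) = F k := by
  subst hk
  rfl

/-- **on the tower the family IS the prescription** (`2 ≤ Lc`): `onTowerFamily Lc M F (towerTorus Lc M k) = F k` for EVERY storey `k`. -/
theorem onTowerFamily_towerTorus (hLc : 2 ≤ Lc) (M : Fin (d + 1) → ℕ) [∀ μ, NeZero (M μ)]
    (F : (k : ℕ) → Matrix (↥(pbox (towerTorus Lc M k)) × Fin (d + 1)) (↥(pbox (towerTorus Lc M k)) × Fin (d + 1)) ℝ) (k : ℕ) :
    onTowerFamily Lc M F (towerTorus Lc M k) = F k := by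
  have hex : ∃ k', towerTorus Lc M k' = towerTorus Lc M k := ⟨k, rfl⟩
  unfold onTowerFamily
  rw [dif_pos hex]
  exact submatrix_reidx_storey Lc M F (towerTorus_injective Lc hLc M hex.choose_spec) _

/-- the top storey literally: `onTowerFamily Lc M F M = F 0` (`towerTorus Lc M 0 = M` is `rfl`). -/
theorem onTowerFamily_top (hLc : 2 ≤ Lc) (M : Fin (d + 1) → ℕ) [∀ μ, NeZero (M μ)]
    (F : (k : ℕ) → Matrix (↥(pbox (towerTorus Lc M k)) × Fin (d + 1)) (↥(pbox (towerTorus Lc M k)) × Fin (d + 1)) ℝ) :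
    onTowerFamily Lc M F M = F 0 :=
  onTowerFamily_towerTorus Lc hLc M F 0

/-- off the tower the family vanishes. -/
theorem onTowerFamily_eq_zero (M : Fin (d + 1) → ℕ)
    (F : (k : ℕ) → Matrix (↥(pbox (towerTorus Lc M k)) × Fin (d + 1)) (↥(pbox (towerTorus Lc M k)) × Fin (d + 1)) ℝ)
    (T : Fin (d + 1) → ℕ) (hT : ∀ k, towerTorus Lc M k ≠ T) : onTowerFamily Lc M F T = 0 := by
  unfold onTowerFamily
  rw [dif_neg (fun h => h.elim fun k hk => hT k hk)]

/-- parity passes from the prescription to the family (no hypothesis on `Lc`): antisymmetric storeys give an antisymmetric family on EVERY torus. -/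
theorem onTowerFamily_transpose (M : Fin (d + 1) → ℕ)
    (F : (k : ℕ) → Matrix (↥(pbox (towerTorus Lc M k)) × Fin (d + 1)) (↥(pbox (towerTorus Lc M k)) × Fin (d + 1)) ℝ)
    (hF : ∀ k, (F k)ᵀ = -F k) (T : Fin (d + 1) → ℕ) : (onTowerFamily Lc M F T)ᵀ = -onTowerFamily Lc M F T := by
  unfold onTowerFamily
  split_ifs with h
  · rw [transpose_submatrix, hF]
    rfl
  · rw [transpose_zero, neg_zero]

/-- linearity of the extension in the prescription: sums. -/
theorem onTowerFamily_add (M : Fin (d + 1) → ℕ)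
    (F₁ F₂ : (k : ℕ) → Matrix (↥(pbox (towerTorus Lc M k)) × Fin (d + 1)) (↥(pbox (towerTorus Lc M k)) × Fin (d + 1)) ℝ)
    (T : Fin (d + 1) → ℕ) : onTowerFamily Lc M (F₁ + F₂) T = onTowerFamily Lc M F₁ T + onTowerFamily Lc M F₂ T := by
  unfold onTowerFamily
  split_ifs with h
  · rfl
  · rw [add_zero]

/-- linearity of the extension in the prescription: scalars. -/
theorem onTowerFamily_smul (M : Fin (d + 1) → ℕ) (c : ℝ)
    (F : (k : ℕ) → Matrix (↥(pbox (towerTorus Lc M k)) × Fin (d + 1)) (↥(pbox (towerTorus Lc M k)) × Fin (d + 1)) ℝ)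
    (T : Fin (d + 1) → ℕ) : onTowerFamily Lc M (c • F) T = c • onTowerFamily Lc M F T := by
  unfold onTowerFamily
  split_ifs with h
  · rfl
  · rw [smul_zero]

/-- the family as ONE function of the direction: for storey prescriptions LINEAR in an abstract direction `v`, the extension is linear in `v` on every torus
(what a door's displayed `hH₁l` asks of `v ↦ compSumSym Lc (onTowerFamily Lc M (F v)) …`, together with `compSumG_add ∕ compSumG_smul`). -/
theorem onTowerFamily_linear {V : Type*} [AddCommGroup V] [Module ℝ V] (M : Fin (d + 1) → ℕ)
    (F : V → (k : ℕ) → Matrix (↥(pbox (towerTorus Lc M k)) × Fin (d + 1)) (↥(pbox (towerTorus Lc M k)) × Fin (d + 1)) ℝ)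
    (hF : ∀ (r : ℝ) (x y : V), F (r • x + y) = r • F x + F y) (r : ℝ) (x y : V) (T : Fin (d + 1) → ℕ) :
    onTowerFamily Lc M (F (r • x + y)) T = r • onTowerFamily Lc M (F x) T + onTowerFamily Lc M (F y) T := by
  rw [hF, onTowerFamily_add, onTowerFamily_smul]

end Summit.QuantumFields.BalabanUV.Beta.FP.TorusCompositeCompanionFamilyG

end
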